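import Literature.Computability.AlgebraicComplexity.QuantumFunctionalsUpper
import Literature.Computability.AlgebraicComplexity.QuantumFunctionalsDegenerationProofs
import HarnessLib

/-!
# Monotonicity of the upper quantum functional under changes of bases and degeneration (CVZ Lemma 3.6)

Topic `Literature/Computability/AlgebraicComplexity`; layer-2 file for the named fact
`ChristandlVranaZuiddam2023_universalSpectralPoint` (CVZ Cor. 3.31), about the upper quantum functional
`F^θ` of `QuantumFunctionalsUpper.lean` (Christandl–Vrana–Zuiddam, J. Amer. Math. Soc. 36 (2023),
Def. 3.3, `k = 3`). CVZ Lemma 3.6 (= Thm. 3.5.4): "If `s ⊵ t`, then `F^θ(s) ≥ F^θ(t)`", with the printed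
proof: `P_λ^{W_S} (A_1 ⊗ ⋯ ⊗ A_k)^{⊗n} = (A_1 ⊗ ⋯ ⊗ A_k)^{⊗n} P_λ^{V_S}`, hence
`∏ P (A·s)^{⊗n} = (A^{⊗n}) ∏ P s^{⊗n}`, so admissibility for `(A ⊗ B ⊗ C)·s` forces admissibility for
`s`, "and by continuity" the same for degenerations. This file PROVES that argument in coordinates for
tensors of one fixed format `ι × κ × μ`:

* `powAct₁/₂/₃` — the `n`-th tensor power `A^{⊗n}` of a linear map acting on the legs of one factor of
  an `n`-fold tensor power; `kroneckerPow_actTensor`: `((A ⊗ B ⊗ C)·t)^{⊗n} = (A^{⊗n} ⊗ B^{⊗n} ⊗ C^{⊗n}) t^{⊗n}`;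
* the commutation of `A^{⊗n}` with the leg permutations, the isotypic character sums and the operator
  `upperProjection` of Def. 3.3 (`upperProjection_powAct`);
* `UpperAdmissible.of_actTensor`: a tuple admissible for `(A ⊗ B ⊗ C)·t` is admissible for `t`
  (any square `A, B, C`, invertible or not) — unconditionally;
* `upperLogQuantumFunctional_actTensor_le` (`E^θ((A ⊗ B ⊗ C)·t) ≤ E^θ(t)`), `GL`-invariance
  `upperLogQuantumFunctional_actTensor_gl`, and **Lemma 3.6 within a format**:
  `upperLogQuantumFunctional_le_of_degeneratesTo` / `upperQuantumFunctional_le_of_degeneratesTo`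
  (`s ⊵ t ⇒ F^θ(t) ≤ F^θ(s)`), the continuity step being the closedness of
  `{v | upperProjection θ λ (v^{⊗n}) = 0}` (`continuous_upperProjection_kroneckerPow`).

The supremum comparisons take the Schur–Weyl vanishing fact `schurWeyl_isotypicSum_eq_zero`
(`QuantumFunctionalsUpper.lean`) as a hypothesis, only to know that the defining sets of `E^θ` are bounded
above (`bddAbove_upperAdmissible_values`); the admissibility statements themselves are unconditional.
Not treated here: restrictions that change the format (CVZ Rem. "tricks": embed both tensors in a
common space), which additionally needs `schurWeyl_isotypicSum_eq_zero` to move dummy partitions — next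
layer. No named facts are introduced; three auxiliary definitions (`powActⱼ`).

Source: M. Christandl, P. Vrana, J. Zuiddam, J. Amer. Math. Soc. 36 (2023) = arXiv:1709.07851v3, §3.1,
Def. 3.3, Thm. 3.5.4, Lemma 3.6 (and its proof).
-/

noncomputable section

open scoped BigOperators

namespace Literature.Computability.AlgebraicComplexity

open Literature.NumberTheory.DiophantineGeometry (spechtCharacter)

universe u

/-! ## Tensor powers of linear maps acting on the legs of one factor -/

section PowAct

variable {ι κ μ ι' κ' μ' : Type u} [Fintype ι] [Fintype κ] [Fintype μ] {n : ℕ}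

/-- `A^{⊗n} ⊗ 1 ⊗ 1` on an `n`-fold tensor power in coordinates:
`(A^{⊗n} u)(a', b, c) = ∑_a (∏ᵢ A (a' i) (a i)) u(a, b, c)` (CVZ, proof of Lemma 3.6: the operator
`(A_1 ⊗ ⋯ ⊗ A_k)^{⊗n}`, one factor at a time). [cite: ChristandlVranaZuiddam2023, Lemma 3.6 (proof)] -/
def powAct₁ (A : Matrix ι' ι ℂ) (u : (Fin n → ι) → (Fin n → κ) → (Fin n → μ) → ℂ) :
    (Fin n → ι') → (Fin n → κ) → (Fin n → μ) → ℂ :=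
  fun a' b c => ∑ a : Fin n → ι, (∏ i, A (a' i) (a i)) * u a b c

/-- `1 ⊗ B^{⊗n} ⊗ 1` on an `n`-fold tensor power in coordinates.
[cite: ChristandlVranaZuiddam2023, Lemma 3.6 (proof)] -/
def powAct₂ (B : Matrix κ' κ ℂ) (u : (Fin n → ι) → (Fin n → κ) → (Fin n → μ) → ℂ) :
    (Fin n → ι) → (Fin n → κ') → (Fin n → μ) → ℂ :=
  fun a b' c => ∑ b : Fin n → κ, (∏ i, B (b' i) (b i)) * u a b c

/-- `1 ⊗ 1 ⊗ C^{⊗n}` on an `n`-fold tensor power in coordinates.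
[cite: ChristandlVranaZuiddam2023, Lemma 3.6 (proof)] -/
def powAct₃ (C : Matrix μ' μ ℂ) (u : (Fin n → ι) → (Fin n → κ) → (Fin n → μ) → ℂ) :
    (Fin n → ι) → (Fin n → κ) → (Fin n → μ') → ℂ :=
  fun a b c' => ∑ c : Fin n → μ, (∏ i, C (c' i) (c i)) * u a b c

omit [Fintype κ] [Fintype μ] in
/-- Unfolding of `powAct₁`. [folklore] -/
theorem powAct₁_apply (A : Matrix ι' ι ℂ) (u : (Fin n → ι) → (Fin n → κ) → (Fin n → μ) → ℂ)
    (a' : Fin n → ι') (b : Fin n → κ) (c : Fin n → μ) :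
    powAct₁ A u a' b c = ∑ a : Fin n → ι, (∏ i, A (a' i) (a i)) * u a b c := rfl

omit [Fintype ι] [Fintype μ] in
/-- Unfolding of `powAct₂`. [folklore] -/
theorem powAct₂_apply (B : Matrix κ' κ ℂ) (u : (Fin n → ι) → (Fin n → κ) → (Fin n → μ) → ℂ)
    (a : Fin n → ι) (b' : Fin n → κ') (c : Fin n → μ) :
    powAct₂ B u a b' c = ∑ b : Fin n → κ, (∏ i, B (b' i) (b i)) * u a b c := rfl

omit [Fintype ι] [Fintype κ] in
/-- Unfolding of `powAct₃`. [folklore] -/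
theorem powAct₃_apply (C : Matrix μ' μ ℂ) (u : (Fin n → ι) → (Fin n → κ) → (Fin n → μ) → ℂ)
    (a : Fin n → ι) (b : Fin n → κ) (c' : Fin n → μ') :
    powAct₃ C u a b c' = ∑ c : Fin n → μ, (∏ i, C (c' i) (c i)) * u a b c := rfl

omit [Fintype κ] [Fintype μ] in
/-- `A^{⊗n}` kills the zero tensor. [folklore] -/
@[simp] theorem powAct₁_zero (A : Matrix ι' ι ℂ) :
    powAct₁ A (0 : (Fin n → ι) → (Fin n → κ) → (Fin n → μ) → ℂ) = 0 := by
  funext a b c; simp [powAct₁_apply]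

omit [Fintype ι] [Fintype μ] in
/-- `B^{⊗n}` kills the zero tensor. [folklore] -/
@[simp] theorem powAct₂_zero (B : Matrix κ' κ ℂ) :
    powAct₂ B (0 : (Fin n → ι) → (Fin n → κ) → (Fin n → μ) → ℂ) = 0 := by
  funext a b c; simp [powAct₂_apply]

omit [Fintype ι] [Fintype κ] in
/-- `C^{⊗n}` kills the zero tensor. [folklore] -/
@[simp] theorem powAct₃_zero (C : Matrix μ' μ ℂ) :
    powAct₃ C (0 : (Fin n → ι) → (Fin n → κ) → (Fin n → μ) → ℂ) = 0 := by
  funext a b c; simp [powAct₃_apply]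

omit [Fintype κ] [Fintype μ] in
/-- `A^{⊗n}` is linear: it commutes with finite linear combinations. [folklore] -/
theorem powAct₁_sum_smul {α : Type*} (S : Finset α) (c : α → ℂ)
    (v : α → (Fin n → ι) → (Fin n → κ) → (Fin n → μ) → ℂ) (A : Matrix ι' ι ℂ) :
    powAct₁ A (∑ x ∈ S, c x • v x) = ∑ x ∈ S, c x • powAct₁ A (v x) := by
  funext a' b d
  simp only [powAct₁_apply, Finset.sum_apply, Pi.smul_apply, smul_eq_mul, Finset.mul_sum]
  rw [Finset.sum_comm]
  refine Finset.sum_congr rfl fun x _ => Finset.sum_congr rfl fun a _ => ?_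
  ring

omit [Fintype ι] [Fintype μ] in
/-- `B^{⊗n}` is linear. [folklore] -/
theorem powAct₂_sum_smul {α : Type*} (S : Finset α) (c : α → ℂ)
    (v : α → (Fin n → ι) → (Fin n → κ) → (Fin n → μ) → ℂ) (B : Matrix κ' κ ℂ) :
    powAct₂ B (∑ x ∈ S, c x • v x) = ∑ x ∈ S, c x • powAct₂ B (v x) := by
  funext a b' d
  simp only [powAct₂_apply, Finset.sum_apply, Pi.smul_apply, smul_eq_mul, Finset.mul_sum]
  rw [Finset.sum_comm]
  refine Finset.sum_congr rfl fun x _ => Finset.sum_congr rfl fun a _ => ?_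
  ring

omit [Fintype ι] [Fintype κ] in
/-- `C^{⊗n}` is linear. [folklore] -/
theorem powAct₃_sum_smul {α : Type*} (S : Finset α) (c : α → ℂ)
    (v : α → (Fin n → ι) → (Fin n → κ) → (Fin n → μ) → ℂ) (C : Matrix μ' μ ℂ) :
    powAct₃ C (∑ x ∈ S, c x • v x) = ∑ x ∈ S, c x • powAct₃ C (v x) := by
  funext a b d'
  simp only [powAct₃_apply, Finset.sum_apply, Pi.smul_apply, smul_eq_mul, Finset.mul_sum]
  rw [Finset.sum_comm]
  refine Finset.sum_congr rfl fun x _ => Finset.sum_congr rfl fun a _ => ?_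
  ring

/-! ### Tensor powers of the action -/

variable [DecidableEq ι] [DecidableEq κ] [DecidableEq μ]

omit [DecidableEq ι] in
/-- `(A ⊗ 1 ⊗ 1)·t` entrywise. [folklore] -/
theorem actTensor_one_one_apply (A : Matrix ι' ι ℂ) (t : ι → κ → μ → ℂ) (x : ι') (y : κ) (z : μ) :
    actTensor A (1 : Matrix κ κ ℂ) (1 : Matrix μ μ ℂ) t x y z = ∑ x', A x x' * t x' y z := by
  simp only [actTensor_apply, Matrix.one_apply, mul_ite, mul_one, mul_zero, ite_mul, zero_mul,
    Finset.sum_ite_eq, Finset.mem_univ, if_true]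

omit [DecidableEq κ] in
/-- `(1 ⊗ B ⊗ 1)·t` entrywise. [folklore] -/
theorem one_actTensor_one_apply (B : Matrix κ' κ ℂ) (t : ι → κ → μ → ℂ) (x : ι) (y : κ') (z : μ) :
    actTensor (1 : Matrix ι ι ℂ) B (1 : Matrix μ μ ℂ) t x y z = ∑ y', B y y' * t x y' z := by
  rw [actTensor_apply, Finset.sum_eq_single x]
  · refine Finset.sum_congr rfl fun y' _ => ?_
    rw [Finset.sum_eq_single z]
    · simp
    · intro z' _ hz'
      simp [Matrix.one_apply_ne (Ne.symm hz')]
    · simp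
  · intro x' _ hx'
    simp [Matrix.one_apply_ne (Ne.symm hx')]
  · simp

omit [DecidableEq μ] in
/-- `(1 ⊗ 1 ⊗ C)·t` entrywise. [folklore] -/
theorem one_one_actTensor_apply (C : Matrix μ' μ ℂ) (t : ι → κ → μ → ℂ) (x : ι) (y : κ) (z : μ') :
    actTensor (1 : Matrix ι ι ℂ) (1 : Matrix κ κ ℂ) C t x y z = ∑ z', C z z' * t x y z' := by
  rw [actTensor_apply, Finset.sum_eq_single x]
  · rw [Finset.sum_eq_single y]
    · simp
    · intro y' _ hy'
      simp [Matrix.one_apply_ne (Ne.symm hy')]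
    · simp
  · intro x' _ hx'
    simp [Matrix.one_apply_ne (Ne.symm hx')]
  · simp

omit [DecidableEq ι] in
/-- `((A ⊗ 1 ⊗ 1)·t)^{⊗n} = A^{⊗n} t^{⊗n}` (multiplicativity of tensor powers).
[cite: ChristandlVranaZuiddam2023, Lemma 3.6 (proof)] -/
theorem kroneckerPow_actTensor₁ (A : Matrix ι' ι ℂ) (t : ι → κ → μ → ℂ) (n : ℕ) :
    kroneckerPow (actTensor A (1 : Matrix κ κ ℂ) (1 : Matrix μ μ ℂ) t) n =
      powAct₁ A (kroneckerPow t n) := by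
  funext a' b c
  simp only [kroneckerPow_apply, powAct₁_apply, actTensor_one_one_apply]
  rw [Finset.prod_univ_sum (fun _ => Finset.univ) (fun i x' => A (a' i) x' * t x' (b i) (c i)),
    Fintype.piFinset_univ]
  refine Finset.sum_congr rfl fun a _ => ?_
  rw [Finset.prod_mul_distrib]

omit [DecidableEq κ] in
/-- `((1 ⊗ B ⊗ 1)·t)^{⊗n} = B^{⊗n} t^{⊗n}`. [cite: ChristandlVranaZuiddam2023, Lemma 3.6 (proof)] -/
theorem kroneckerPow_actTensor₂ (B : Matrix κ' κ ℂ) (t : ι → κ → μ → ℂ) (n : ℕ) :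
    kroneckerPow (actTensor (1 : Matrix ι ι ℂ) B (1 : Matrix μ μ ℂ) t) n =
      powAct₂ B (kroneckerPow t n) := by
  funext a b' c
  simp only [kroneckerPow_apply, powAct₂_apply, one_actTensor_one_apply]
  rw [Finset.prod_univ_sum (fun _ => Finset.univ) (fun i y' => B (b' i) y' * t (a i) y' (c i)),
    Fintype.piFinset_univ]
  refine Finset.sum_congr rfl fun b _ => ?_
  rw [Finset.prod_mul_distrib]

omit [DecidableEq μ] in
/-- `((1 ⊗ 1 ⊗ C)·t)^{⊗n} = C^{⊗n} t^{⊗n}`. [cite: ChristandlVranaZuiddam2023, Lemma 3.6 (proof)] -/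
theorem kroneckerPow_actTensor₃ (C : Matrix μ' μ ℂ) (t : ι → κ → μ → ℂ) (n : ℕ) :
    kroneckerPow (actTensor (1 : Matrix ι ι ℂ) (1 : Matrix κ κ ℂ) C t) n =
      powAct₃ C (kroneckerPow t n) := by
  funext a b c'
  simp only [kroneckerPow_apply, powAct₃_apply, one_one_actTensor_apply]
  rw [Finset.prod_univ_sum (fun _ => Finset.univ) (fun i z' => C (c' i) z' * t (a i) (b i) z'),
    Fintype.piFinset_univ]
  refine Finset.sum_congr rfl fun c _ => ?_
  rw [Finset.prod_mul_distrib]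

omit [DecidableEq μ] in
/-- **Tensor powers are multiplicative**: `((A ⊗ B ⊗ C)·t)^{⊗n} = (A^{⊗n} ⊗ B^{⊗n} ⊗ C^{⊗n}) t^{⊗n}`
(CVZ, proof of Lemma 3.6). [cite: ChristandlVranaZuiddam2023, Lemma 3.6 (proof)] -/
theorem kroneckerPow_actTensor [Fintype ι'] [Fintype κ'] [Fintype μ'] [DecidableEq κ'] [DecidableEq μ']
    (A : Matrix ι' ι ℂ) (B : Matrix κ' κ ℂ) (C : Matrix μ' μ ℂ) (t : ι → κ → μ → ℂ) (n : ℕ) :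
    kroneckerPow (actTensor A B C t) n = powAct₁ A (powAct₂ B (powAct₃ C (kroneckerPow t n))) := by
  have h : actTensor A B C t = actTensor A (1 : Matrix κ' κ' ℂ) (1 : Matrix μ' μ' ℂ)
      (actTensor (1 : Matrix ι ι ℂ) B (1 : Matrix μ' μ' ℂ) (actTensor (1 : Matrix ι ι ℂ) (1 : Matrix κ κ ℂ) C t)) := by
    rw [actTensor_actTensor, actTensor_actTensor]
    simp
  rw [h, kroneckerPow_actTensor₁, kroneckerPow_actTensor₂, kroneckerPow_actTensor₃]

/-! ### Commutation with leg permutations and isotypic sums -/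

omit [Fintype κ] [Fintype μ] [DecidableEq ι] [DecidableEq κ] [DecidableEq μ] in
/-- `A^{⊗n}` commutes with the permutations of the legs it acts on (it is `S_n`-equivariant).
[cite: ChristandlVranaZuiddam2023, Lemma 3.6 (proof)] -/
theorem permLegs₁_powAct₁ (π : Equiv.Perm (Fin n)) (A : Matrix ι' ι ℂ)
    (u : (Fin n → ι) → (Fin n → κ) → (Fin n → μ) → ℂ) :
    permLegs₁ π (powAct₁ A u) = powAct₁ A (permLegs₁ π u) := by
  funext a' b c
  simp only [permLegs₁_apply, powAct₁_apply]
  -- reindex the sum by `a ↦ a ∘ π`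
  refine (Fintype.sum_equiv (π.symm.arrowCongr (Equiv.refl ι)) _ _ fun a => ?_).symm
  have he : (π.symm.arrowCongr (Equiv.refl ι)) a = a ∘ π := by
    funext i; simp [Equiv.arrowCongr_apply]
  rw [he]
  congr 1
  exact (Fintype.prod_equiv π _ _ fun i => rfl).symm

omit [Fintype ι] [Fintype μ] [DecidableEq ι] [DecidableEq κ] [DecidableEq μ] in
/-- `B^{⊗n}` is `S_n`-equivariant on its legs. [cite: ChristandlVranaZuiddam2023, Lemma 3.6 (proof)] -/
theorem permLegs₂_powAct₂ (π : Equiv.Perm (Fin n)) (B : Matrix κ' κ ℂ)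
    (u : (Fin n → ι) → (Fin n → κ) → (Fin n → μ) → ℂ) :
    permLegs₂ π (powAct₂ B u) = powAct₂ B (permLegs₂ π u) := by
  funext a b' c
  simp only [permLegs₂_apply, powAct₂_apply]
  refine (Fintype.sum_equiv (π.symm.arrowCongr (Equiv.refl κ)) _ _ fun b => ?_).symm
  have he : (π.symm.arrowCongr (Equiv.refl κ)) b = b ∘ π := by
    funext i; simp [Equiv.arrowCongr_apply]
  rw [he]
  congr 1
  exact (Fintype.prod_equiv π _ _ fun i => rfl).symm

omit [Fintype ι] [Fintype κ] [DecidableEq ι] [DecidableEq κ] [DecidableEq μ] in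
/-- `C^{⊗n}` is `S_n`-equivariant on its legs. [cite: ChristandlVranaZuiddam2023, Lemma 3.6 (proof)] -/
theorem permLegs₃_powAct₃ (π : Equiv.Perm (Fin n)) (C : Matrix μ' μ ℂ)
    (u : (Fin n → ι) → (Fin n → κ) → (Fin n → μ) → ℂ) :
    permLegs₃ π (powAct₃ C u) = powAct₃ C (permLegs₃ π u) := by
  funext a b c'
  simp only [permLegs₃_apply, powAct₃_apply]
  refine (Fintype.sum_equiv (π.symm.arrowCongr (Equiv.refl μ)) _ _ fun c => ?_).symm
  have he : (π.symm.arrowCongr (Equiv.refl μ)) c = c ∘ π := by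
    funext i; simp [Equiv.arrowCongr_apply]
  rw [he]
  congr 1
  exact (Fintype.prod_equiv π _ _ fun i => rfl).symm

omit [Fintype κ] [Fintype μ] [DecidableEq ι] [DecidableEq κ] [DecidableEq μ] in
/-- Leg permutations of another factor commute with `A^{⊗n}` trivially. [folklore] -/
theorem permLegs₂_powAct₁ (π : Equiv.Perm (Fin n)) (A : Matrix ι' ι ℂ)
    (u : (Fin n → ι) → (Fin n → κ) → (Fin n → μ) → ℂ) :
    permLegs₂ π (powAct₁ A u) = powAct₁ A (permLegs₂ π u) := rfl

omit [Fintype κ] [Fintype μ] [DecidableEq ι] [DecidableEq κ] [DecidableEq μ] in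
/-- Leg permutations of another factor commute with `A^{⊗n}` trivially. [folklore] -/
theorem permLegs₃_powAct₁ (π : Equiv.Perm (Fin n)) (A : Matrix ι' ι ℂ)
    (u : (Fin n → ι) → (Fin n → κ) → (Fin n → μ) → ℂ) :
    permLegs₃ π (powAct₁ A u) = powAct₁ A (permLegs₃ π u) := rfl

omit [Fintype ι] [Fintype μ] [DecidableEq ι] [DecidableEq κ] [DecidableEq μ] in
/-- Leg permutations of another factor commute with `B^{⊗n}` trivially. [folklore] -/
theorem permLegs₁_powAct₂ (π : Equiv.Perm (Fin n)) (B : Matrix κ' κ ℂ)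
    (u : (Fin n → ι) → (Fin n → κ) → (Fin n → μ) → ℂ) :
    permLegs₁ π (powAct₂ B u) = powAct₂ B (permLegs₁ π u) := rfl

omit [Fintype ι] [Fintype μ] [DecidableEq ι] [DecidableEq κ] [DecidableEq μ] in
/-- Leg permutations of another factor commute with `B^{⊗n}` trivially. [folklore] -/
theorem permLegs₃_powAct₂ (π : Equiv.Perm (Fin n)) (B : Matrix κ' κ ℂ)
    (u : (Fin n → ι) → (Fin n → κ) → (Fin n → μ) → ℂ) :
    permLegs₃ π (powAct₂ B u) = powAct₂ B (permLegs₃ π u) := rfl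

omit [Fintype ι] [Fintype κ] [DecidableEq ι] [DecidableEq κ] [DecidableEq μ] in
/-- Leg permutations of another factor commute with `C^{⊗n}` trivially. [folklore] -/
theorem permLegs₁_powAct₃ (π : Equiv.Perm (Fin n)) (C : Matrix μ' μ ℂ)
    (u : (Fin n → ι) → (Fin n → κ) → (Fin n → μ) → ℂ) :
    permLegs₁ π (powAct₃ C u) = powAct₃ C (permLegs₁ π u) := rfl

omit [Fintype ι] [Fintype κ] [DecidableEq ι] [DecidableEq κ] [DecidableEq μ] in
/-- Leg permutations of another factor commute with `C^{⊗n}` trivially. [folklore] -/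
theorem permLegs₂_powAct₃ (π : Equiv.Perm (Fin n)) (C : Matrix μ' μ ℂ)
    (u : (Fin n → ι) → (Fin n → κ) → (Fin n → μ) → ℂ) :
    permLegs₂ π (powAct₃ C u) = powAct₃ C (permLegs₂ π u) := rfl

omit [Fintype κ] [Fintype μ] [DecidableEq ι] [DecidableEq κ] [DecidableEq μ] in
/-- The isotypic character sums commute with `A^{⊗n}` (`P_λ^{W} A^{⊗n} = A^{⊗n} P_λ^{V}`, CVZ proof of
Lemma 3.6). [cite: ChristandlVranaZuiddam2023, Lemma 3.6 (proof)] -/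
theorem isotypicSum_powAct₁ (lam : Nat.Partition n) (A : Matrix ι' ι ℂ)
    (u : (Fin n → ι) → (Fin n → κ) → (Fin n → μ) → ℂ) :
    isotypicSum₁ lam (powAct₁ A u) = powAct₁ A (isotypicSum₁ lam u) ∧
    isotypicSum₂ lam (powAct₁ A u) = powAct₁ A (isotypicSum₂ lam u) ∧
    isotypicSum₃ lam (powAct₁ A u) = powAct₁ A (isotypicSum₃ lam u) := by
  refine ⟨?_, ?_, ?_⟩
  · simp only [isotypicSum₁, powAct₁_sum_smul, permLegs₁_powAct₁]
  · simp only [isotypicSum₂, powAct₁_sum_smul, permLegs₂_powAct₁]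
  · simp only [isotypicSum₃, powAct₁_sum_smul, permLegs₃_powAct₁]

omit [Fintype ι] [Fintype μ] [DecidableEq ι] [DecidableEq κ] [DecidableEq μ] in
/-- The isotypic character sums commute with `B^{⊗n}`. [cite: ChristandlVranaZuiddam2023, Lemma 3.6 (proof)] -/
theorem isotypicSum_powAct₂ (lam : Nat.Partition n) (B : Matrix κ' κ ℂ)
    (u : (Fin n → ι) → (Fin n → κ) → (Fin n → μ) → ℂ) :
    isotypicSum₁ lam (powAct₂ B u) = powAct₂ B (isotypicSum₁ lam u) ∧
    isotypicSum₂ lam (powAct₂ B u) = powAct₂ B (isotypicSum₂ lam u) ∧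
    isotypicSum₃ lam (powAct₂ B u) = powAct₂ B (isotypicSum₃ lam u) := by
  refine ⟨?_, ?_, ?_⟩
  · simp only [isotypicSum₁, powAct₂_sum_smul, permLegs₁_powAct₂]
  · simp only [isotypicSum₂, powAct₂_sum_smul, permLegs₂_powAct₂]
  · simp only [isotypicSum₃, powAct₂_sum_smul, permLegs₃_powAct₂]

omit [Fintype ι] [Fintype κ] [DecidableEq ι] [DecidableEq κ] [DecidableEq μ] in
/-- The isotypic character sums commute with `C^{⊗n}`. [cite: ChristandlVranaZuiddam2023, Lemma 3.6 (proof)] -/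
theorem isotypicSum_powAct₃ (lam : Nat.Partition n) (C : Matrix μ' μ ℂ)
    (u : (Fin n → ι) → (Fin n → κ) → (Fin n → μ) → ℂ) :
    isotypicSum₁ lam (powAct₃ C u) = powAct₃ C (isotypicSum₁ lam u) ∧
    isotypicSum₂ lam (powAct₃ C u) = powAct₃ C (isotypicSum₂ lam u) ∧
    isotypicSum₃ lam (powAct₃ C u) = powAct₃ C (isotypicSum₃ lam u) := by
  refine ⟨?_, ?_, ?_⟩
  · simp only [isotypicSum₁, powAct₃_sum_smul, permLegs₁_powAct₃]
  · simp only [isotypicSum₂, powAct₃_sum_smul, permLegs₂_powAct₃]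
  · simp only [isotypicSum₃, powAct₃_sum_smul, permLegs₃_powAct₃]

omit [Fintype κ] [Fintype μ] [DecidableEq ι] [DecidableEq κ] [DecidableEq μ] in
/-- The operator `∏_{j ∈ supp θ} P_{λ^{(j)}}` of Def. 3.3 commutes with `A^{⊗n}`.
[cite: ChristandlVranaZuiddam2023, Lemma 3.6 (proof)] -/
theorem upperProjection_powAct₁ (θ : Fin 3 → ℝ) (lam : Fin 3 → Nat.Partition n) (A : Matrix ι' ι ℂ)
    (u : (Fin n → ι) → (Fin n → κ) → (Fin n → μ) → ℂ) :
    upperProjection θ lam (powAct₁ A u) = powAct₁ A (upperProjection θ lam u) := by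
  classical
  simp only [upperProjection]
  split_ifs <;>
    simp only [(isotypicSum_powAct₁ _ A _).1, (isotypicSum_powAct₁ _ A _).2.1,
      (isotypicSum_powAct₁ _ A _).2.2]

omit [Fintype ι] [Fintype μ] [DecidableEq ι] [DecidableEq κ] [DecidableEq μ] in
/-- The operator of Def. 3.3 commutes with `B^{⊗n}`. [cite: ChristandlVranaZuiddam2023, Lemma 3.6 (proof)] -/
theorem upperProjection_powAct₂ (θ : Fin 3 → ℝ) (lam : Fin 3 → Nat.Partition n) (B : Matrix κ' κ ℂ)
    (u : (Fin n → ι) → (Fin n → κ) → (Fin n → μ) → ℂ) :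
    upperProjection θ lam (powAct₂ B u) = powAct₂ B (upperProjection θ lam u) := by
  classical
  simp only [upperProjection]
  split_ifs <;>
    simp only [(isotypicSum_powAct₂ _ B _).1, (isotypicSum_powAct₂ _ B _).2.1,
      (isotypicSum_powAct₂ _ B _).2.2]

omit [Fintype ι] [Fintype κ] [DecidableEq ι] [DecidableEq κ] [DecidableEq μ] in
/-- The operator of Def. 3.3 commutes with `C^{⊗n}`. [cite: ChristandlVranaZuiddam2023, Lemma 3.6 (proof)] -/
theorem upperProjection_powAct₃ (θ : Fin 3 → ℝ) (lam : Fin 3 → Nat.Partition n) (C : Matrix μ' μ ℂ)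
    (u : (Fin n → ι) → (Fin n → κ) → (Fin n → μ) → ℂ) :
    upperProjection θ lam (powAct₃ C u) = powAct₃ C (upperProjection θ lam u) := by
  classical
  simp only [upperProjection]
  split_ifs <;>
    simp only [(isotypicSum_powAct₃ _ C _).1, (isotypicSum_powAct₃ _ C _).2.1,
      (isotypicSum_powAct₃ _ C _).2.2]

end PowAct

/-! ## Admissibility transfers against restrictions; `E^θ` is monotone -/

section Monotone

variable {ι κ μ : Type u} [Fintype ι] [Fintype κ] [Fintype μ] [DecidableEq ι] [DecidableEq κ]
  [DecidableEq μ]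

/-- **Admissibility transfers along restrictions** (CVZ, proof of Lemma 3.6:
`∏ P (A·s)^{⊗n} = A^{⊗n} ∏ P s^{⊗n}`): if a tuple is admissible for `(A ⊗ B ⊗ C)·t` then it is
admissible for `t` — for arbitrary square `A, B, C`. [cite: ChristandlVranaZuiddam2023, Lemma 3.6] -/
theorem UpperAdmissible.of_actTensor {θ : Fin 3 → ℝ} {A : Matrix ι ι ℂ} {B : Matrix κ κ ℂ}
    {C : Matrix μ μ ℂ} {t : ι → κ → μ → ℂ} {n : ℕ} {lam : Fin 3 → Nat.Partition n}
    (h : UpperAdmissible θ (actTensor A B C t) n lam) : UpperAdmissible θ t n lam := by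
  intro h0
  apply h
  rw [kroneckerPow_actTensor, upperProjection_powAct₁, upperProjection_powAct₂, upperProjection_powAct₃,
    h0, powAct₃_zero, powAct₂_zero, powAct₁_zero]

/-- The defining set of `E^θ((A ⊗ B ⊗ C)·t)` is contained in that of `E^θ(t)`.
[cite: ChristandlVranaZuiddam2023, Lemma 3.6] -/
theorem upperValues_actTensor_subset (θ : Fin 3 → ℝ) (A : Matrix ι ι ℂ) (B : Matrix κ κ ℂ)
    (C : Matrix μ μ ℂ) (t : ι → κ → μ → ℂ) :
    {x : ℝ | ∃ (n : ℕ) (lam : Fin 3 → Nat.Partition n),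
        0 < n ∧ UpperAdmissible θ (actTensor A B C t) n lam ∧ x = weightedPartitionEntropy θ lam} ⊆
      {x : ℝ | ∃ (n : ℕ) (lam : Fin 3 → Nat.Partition n),
        0 < n ∧ UpperAdmissible θ t n lam ∧ x = weightedPartitionEntropy θ lam} := by
  rintro x ⟨n, lam, hn, hadm, rfl⟩
  exact ⟨n, lam, hn, hadm.of_actTensor, rfl⟩

omit [Fintype ι] [Fintype κ] [Fintype μ] [DecidableEq ι] [DecidableEq κ] [DecidableEq μ] in
/-- Values of admissible tuples are nonnegative for `θ ≥ 0`. [folklore] -/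
theorem weightedPartitionEntropy_nonneg {θ : Fin 3 → ℝ} (hθ : ∀ j, 0 ≤ θ j) {n : ℕ}
    (lam : Fin 3 → Nat.Partition n) : 0 ≤ weightedPartitionEntropy θ lam :=
  add_nonneg (add_nonneg (mul_nonneg (hθ 0) (partitionEntropy_nonneg _))
    (mul_nonneg (hθ 1) (partitionEntropy_nonneg _))) (mul_nonneg (hθ 2) (partitionEntropy_nonneg _))

omit [Fintype ι] [Fintype κ] [Fintype μ] [DecidableEq ι] [DecidableEq κ] [DecidableEq μ] in
/-- `E^θ(t) ≥ 0` for `θ ≥ 0` (every value is `≥ 0`; `sSup ∅ = 0`). [folklore] -/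
theorem upperLogQuantumFunctional_nonneg {θ : Fin 3 → ℝ} (hθ : ∀ j, 0 ≤ θ j) (t : ι → κ → μ → ℂ) :
    0 ≤ upperLogQuantumFunctional θ t := by
  refine Real.sSup_nonneg ?_
  rintro x ⟨n, lam, -, -, rfl⟩
  exact weightedPartitionEntropy_nonneg hθ lam

omit [DecidableEq ι] [DecidableEq κ] [DecidableEq μ] in
/-- Monotonicity of `E^θ` along an inclusion of defining sets (bounded thanks to Schur–Weyl vanishing).
[folklore] -/
theorem upperLogQuantumFunctional_le_of_subset (hSW : schurWeyl_isotypicSum_eq_zero.{u}) {θ : Fin 3 → ℝ}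
    (hθ : ∀ j, 0 ≤ θ j) {s t : ι → κ → μ → ℂ}
    (h : {x : ℝ | ∃ (n : ℕ) (lam : Fin 3 → Nat.Partition n),
        0 < n ∧ UpperAdmissible θ t n lam ∧ x = weightedPartitionEntropy θ lam} ⊆
      {x : ℝ | ∃ (n : ℕ) (lam : Fin 3 → Nat.Partition n),
        0 < n ∧ UpperAdmissible θ s n lam ∧ x = weightedPartitionEntropy θ lam}) :
    upperLogQuantumFunctional θ t ≤ upperLogQuantumFunctional θ s := by
  by_cases hne : {x : ℝ | ∃ (n : ℕ) (lam : Fin 3 → Nat.Partition n),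
      0 < n ∧ UpperAdmissible θ t n lam ∧ x = weightedPartitionEntropy θ lam}.Nonempty
  · exact csSup_le_csSup (bddAbove_upperAdmissible_values hSW hθ s) hne h
  · rw [Set.not_nonempty_iff_eq_empty] at hne
    rw [upperLogQuantumFunctional, hne, Real.sSup_empty]
    exact upperLogQuantumFunctional_nonneg hθ s

/-- **`E^θ((A ⊗ B ⊗ C)·t) ≤ E^θ(t)` for arbitrary square `A, B, C`** (CVZ Lemma 3.6 for restrictions
within a format; Schur–Weyl vanishing is used only for boundedness of the suprema).
[cite: ChristandlVranaZuiddam2023, Lemma 3.6] -/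
theorem upperLogQuantumFunctional_actTensor_le (hSW : schurWeyl_isotypicSum_eq_zero.{u}) {θ : Fin 3 → ℝ}
    (hθ : ∀ j, 0 ≤ θ j) (A : Matrix ι ι ℂ) (B : Matrix κ κ ℂ) (C : Matrix μ μ ℂ) (t : ι → κ → μ → ℂ) :
    upperLogQuantumFunctional θ (actTensor A B C t) ≤ upperLogQuantumFunctional θ t :=
  upperLogQuantumFunctional_le_of_subset hSW hθ (upperValues_actTensor_subset θ A B C t)

/-- **`GL`-invariance of `E^θ`**: `E^θ(g·t) = E^θ(t)` for `g ∈ GL × GL × GL`.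
[cite: ChristandlVranaZuiddam2023, Lemma 3.6] -/
theorem upperLogQuantumFunctional_actTensor_gl (hSW : schurWeyl_isotypicSum_eq_zero.{u}) {θ : Fin 3 → ℝ}
    (hθ : ∀ j, 0 ≤ θ j) (g : GL ι ℂ × GL κ ℂ × GL μ ℂ) (t : ι → κ → μ → ℂ) :
    upperLogQuantumFunctional θ
        (actTensor (g.1 : Matrix ι ι ℂ) (g.2.1 : Matrix κ κ ℂ) (g.2.2 : Matrix μ μ ℂ) t) =
      upperLogQuantumFunctional θ t := by
  refine le_antisymm (upperLogQuantumFunctional_actTensor_le hSW hθ _ _ _ t) ?_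
  have h := upperLogQuantumFunctional_actTensor_le hSW hθ ((g.1⁻¹ : GL ι ℂ) : Matrix ι ι ℂ)
    ((g.2.1⁻¹ : GL κ ℂ) : Matrix κ κ ℂ) ((g.2.2⁻¹ : GL μ ℂ) : Matrix μ μ ℂ)
    (actTensor (g.1 : Matrix ι ι ℂ) (g.2.1 : Matrix κ κ ℂ) (g.2.2 : Matrix μ μ ℂ) t)
  rwa [actTensor_actTensor, Units.inv_mul, Units.inv_mul, Units.inv_mul, actTensor_one] at h

/-! ### Continuity and degenerations -/

omit [Fintype ι] [Fintype κ] [Fintype μ] [DecidableEq ι] [DecidableEq κ] [DecidableEq μ] in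
/-- `t ↦ t^{⊗n}` is continuous (entries are monomials). [folklore] -/
theorem continuous_kroneckerPow (n : ℕ) :
    Continuous fun t : ι → κ → μ → ℂ => kroneckerPow t n := by
  refine continuous_pi fun a => continuous_pi fun b => continuous_pi fun c => ?_
  simp only [kroneckerPow_apply]
  exact continuous_finsetProd _ fun i _ =>
    ((continuous_apply (c i)).comp ((continuous_apply (b i)).comp (continuous_apply (a i))))

omit [Fintype ι] [Fintype κ] [Fintype μ] [DecidableEq ι] [DecidableEq κ] [DecidableEq μ] in
/-- Leg permutations are continuous (coordinate maps). [folklore] -/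
theorem continuous_permLegs {n : ℕ} (π : Equiv.Perm (Fin n)) :
    Continuous (permLegs₁ π : ((Fin n → ι) → (Fin n → κ) → (Fin n → μ) → ℂ) → _) ∧
    Continuous (permLegs₂ π : ((Fin n → ι) → (Fin n → κ) → (Fin n → μ) → ℂ) → _) ∧
    Continuous (permLegs₃ π : ((Fin n → ι) → (Fin n → κ) → (Fin n → μ) → ℂ) → _) := by
  refine ⟨?_, ?_, ?_⟩ <;>
    refine continuous_pi fun a => continuous_pi fun b => continuous_pi fun c => ?_
  · exact (continuous_apply c).comp ((continuous_apply b).comp (continuous_apply (a ∘ π)))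
  · exact (continuous_apply c).comp ((continuous_apply (b ∘ π)).comp (continuous_apply a))
  · exact (continuous_apply (c ∘ π)).comp ((continuous_apply b).comp (continuous_apply a))

omit [Fintype ι] [Fintype κ] [Fintype μ] [DecidableEq ι] [DecidableEq κ] [DecidableEq μ] in
/-- The isotypic character sums are continuous (finite linear combinations of coordinate maps).
[folklore] -/
theorem continuous_isotypicSum {n : ℕ} (lam : Nat.Partition n) :
    Continuous (isotypicSum₁ lam : ((Fin n → ι) → (Fin n → κ) → (Fin n → μ) → ℂ) → _) ∧
    Continuous (isotypicSum₂ lam : ((Fin n → ι) → (Fin n → κ) → (Fin n → μ) → ℂ) → _) ∧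
    Continuous (isotypicSum₃ lam : ((Fin n → ι) → (Fin n → κ) → (Fin n → μ) → ℂ) → _) := by
  have e₁ : (isotypicSum₁ lam : ((Fin n → ι) → (Fin n → κ) → (Fin n → μ) → ℂ) → _) =
      fun u => ∑ π : Equiv.Perm (Fin n), spechtCharacter ℂ lam π • permLegs₁ π u := rfl
  have e₂ : (isotypicSum₂ lam : ((Fin n → ι) → (Fin n → κ) → (Fin n → μ) → ℂ) → _) =
      fun u => ∑ π : Equiv.Perm (Fin n), spechtCharacter ℂ lam π • permLegs₂ π u := rfl
  have e₃ : (isotypicSum₃ lam : ((Fin n → ι) → (Fin n → κ) → (Fin n → μ) → ℂ) → _) =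
      fun u => ∑ π : Equiv.Perm (Fin n), spechtCharacter ℂ lam π • permLegs₃ π u := rfl
  refine ⟨?_, ?_, ?_⟩
  · rw [e₁]
    exact continuous_finsetSum _ fun π _ =>
      (continuous_permLegs π).1.const_smul (spechtCharacter ℂ lam π)
  · rw [e₂]
    exact continuous_finsetSum _ fun π _ =>
      (continuous_permLegs π).2.1.const_smul (spechtCharacter ℂ lam π)
  · rw [e₃]
    exact continuous_finsetSum _ fun π _ =>
      (continuous_permLegs π).2.2.const_smul (spechtCharacter ℂ lam π)

omit [Fintype ι] [Fintype κ] [Fintype μ] [DecidableEq ι] [DecidableEq κ] [DecidableEq μ] in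
/-- The operator of Def. 3.3 is continuous. [folklore] -/
theorem continuous_upperProjection (θ : Fin 3 → ℝ) {n : ℕ} (lam : Fin 3 → Nat.Partition n) :
    Continuous (upperProjection θ lam : ((Fin n → ι) → (Fin n → κ) → (Fin n → μ) → ℂ) → _) := by
  classical
  have h₁ := (continuous_isotypicSum (ι := ι) (κ := κ) (μ := μ) (lam 0)).1
  have h₂ := (continuous_isotypicSum (ι := ι) (κ := κ) (μ := μ) (lam 1)).2.1
  have h₃ := (continuous_isotypicSum (ι := ι) (κ := κ) (μ := μ) (lam 2)).2.2
  unfold upperProjection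
  split_ifs
  · exact continuous_id
  · exact h₁
  · exact h₂
  · exact h₁.comp h₂
  · exact h₃
  · exact h₁.comp h₃
  · exact h₂.comp h₃
  · exact h₁.comp (h₂.comp h₃)

omit [Fintype ι] [Fintype κ] [Fintype μ] [DecidableEq ι] [DecidableEq κ] [DecidableEq μ] in
/-- `t ↦ (∏_{j ∈ supp θ} P_{λ^{(j)}}) t^{⊗n}` is continuous; its zero set is closed ("by continuity",
CVZ proof of Lemma 3.6). [cite: ChristandlVranaZuiddam2023, Lemma 3.6 (proof)] -/
theorem continuous_upperProjection_kroneckerPow (θ : Fin 3 → ℝ) {n : ℕ} (lam : Fin 3 → Nat.Partition n) :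
    Continuous fun t : ι → κ → μ → ℂ => upperProjection θ lam (kroneckerPow t n) :=
  (continuous_upperProjection θ lam).comp (continuous_kroneckerPow n)

/-- **Admissibility transfers along degenerations**: if `s ⊵ t` (`t` in the closure of the orbit of
`s`) and a tuple is admissible for `t`, it is admissible for `s` (CVZ proof of Lemma 3.6: otherwise
`∏ P (g·s)^{⊗n} = 0` for all `g`, hence for the limit `t`). [cite: ChristandlVranaZuiddam2023, Lemma 3.6] -/
theorem UpperAdmissible.of_degeneratesTo {θ : Fin 3 → ℝ} {s t : ι → κ → μ → ℂ} (hst : TensorDegeneratesTo s t)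
    {n : ℕ} {lam : Fin 3 → Nat.Partition n} (h : UpperAdmissible θ t n lam) : UpperAdmissible θ s n lam := by
  by_contra hs
  apply h
  -- the zero set of the continuous map contains the orbit, hence its closure
  have hzero : ∀ g : GL ι ℂ × GL κ ℂ × GL μ ℂ, upperProjection θ lam (kroneckerPow
      (actTensor (g.1 : Matrix ι ι ℂ) (g.2.1 : Matrix κ κ ℂ) (g.2.2 : Matrix μ μ ℂ) s) n) = 0 := by
    intro g
    by_contra hg
    exact hs (UpperAdmissible.of_actTensor hg)
  have hclosed : IsClosed {v : ι → κ → μ → ℂ | upperProjection θ lam (kroneckerPow v n) = 0} :=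
    isClosed_eq (continuous_upperProjection_kroneckerPow θ lam) continuous_const
  have hsub : (Set.range fun g : GL ι ℂ × GL κ ℂ × GL μ ℂ =>
      actTensor (g.1 : Matrix ι ι ℂ) (g.2.1 : Matrix κ κ ℂ) (g.2.2 : Matrix μ μ ℂ) s) ⊆
      {v : ι → κ → μ → ℂ | upperProjection θ lam (kroneckerPow v n) = 0} := by
    rintro _ ⟨g, rfl⟩
    exact hzero g
  exact hclosed.closure_subset_iff.2 hsub hst

/-- **CVZ Lemma 3.6 (= Thm. 3.5.4) for the logarithmic upper functional, within a format**: if `s ⊵ t`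
then `E^θ(t) ≤ E^θ(s)` (`θ ≥ 0`; Schur–Weyl vanishing only for boundedness of the suprema).
[cite: ChristandlVranaZuiddam2023, Lemma 3.6] -/
theorem upperLogQuantumFunctional_le_of_degeneratesTo (hSW : schurWeyl_isotypicSum_eq_zero.{u})
    {θ : Fin 3 → ℝ} (hθ : ∀ j, 0 ≤ θ j) {s t : ι → κ → μ → ℂ} (hst : TensorDegeneratesTo s t) :
    upperLogQuantumFunctional θ t ≤ upperLogQuantumFunctional θ s := by
  refine upperLogQuantumFunctional_le_of_subset hSW hθ ?_
  rintro x ⟨n, lam, hn, hadm, rfl⟩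
  exact ⟨n, lam, hn, hadm.of_degeneratesTo hst, rfl⟩

/-- **CVZ Lemma 3.6 (= Thm. 3.5.4), within a format**: if `s ⊵ t` then `F^θ(s) ≥ F^θ(t)` for every
`θ ∈ P([3])` (indeed every `θ ≥ 0`), for the upper quantum functional of Def. 3.3 — proved as printed,
given the Schur–Weyl vanishing fact for the finiteness of the suprema.
[cite: ChristandlVranaZuiddam2023, Lemma 3.6] -/
theorem upperQuantumFunctional_le_of_degeneratesTo (hSW : schurWeyl_isotypicSum_eq_zero.{u})
    {θ : Fin 3 → ℝ} (hθ : ∀ j, 0 ≤ θ j) {s t : ι → κ → μ → ℂ} (hst : TensorDegeneratesTo s t) :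
    upperQuantumFunctional θ t ≤ upperQuantumFunctional θ s := by
  by_cases ht : t = 0
  · subst ht
    rw [upperQuantumFunctional_zero]
    exact upperQuantumFunctional_nonneg θ s
  · have hs : s ≠ 0 := by
      rintro rfl
      exact ht hst.eq_zero_of_zero
    rw [upperQuantumFunctional_of_ne_zero θ ht, upperQuantumFunctional_of_ne_zero θ hs]
    exact Real.rpow_le_rpow_of_exponent_le one_le_two
      (upperLogQuantumFunctional_le_of_degeneratesTo hSW hθ hst)

/-- `F^θ((A ⊗ B ⊗ C)·t) ≤ F^θ(t)` for square `A, B, C` (restrictions within a format are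
degenerations, but here directly from `UpperAdmissible.of_actTensor`).
[cite: ChristandlVranaZuiddam2023, Lemma 3.6] -/
theorem upperQuantumFunctional_actTensor_le (hSW : schurWeyl_isotypicSum_eq_zero.{u}) {θ : Fin 3 → ℝ}
    (hθ : ∀ j, 0 ≤ θ j) (A : Matrix ι ι ℂ) (B : Matrix κ κ ℂ) (C : Matrix μ μ ℂ) (t : ι → κ → μ → ℂ) :
    upperQuantumFunctional θ (actTensor A B C t) ≤ upperQuantumFunctional θ t := by
  by_cases h0 : actTensor A B C t = 0
  · rw [h0, upperQuantumFunctional_zero]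
    exact upperQuantumFunctional_nonneg θ t
  · have ht : t ≠ 0 := by
      rintro rfl
      exact h0 (actTensor_zero A B C)
    rw [upperQuantumFunctional_of_ne_zero θ h0, upperQuantumFunctional_of_ne_zero θ ht]
    exact Real.rpow_le_rpow_of_exponent_le one_le_two
      (upperLogQuantumFunctional_actTensor_le hSW hθ A B C t)

end Monotone

end Literature.Computability.AlgebraicComplexity

end
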